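import Literature.AlgebraicGeometry.Frobenioids.ModelFrobenioidUnitTwistVacuityWitness
import Literature.AlgebraicGeometry.Frobenioids.PadicFrobenioidDatumLemmas
import Mathlib.Algebra.CharP.Algebra
import Mathlib.Algebra.Ring.CharZero
import HarnessLib

/-!
# Frobenioids II, Ex. 1.1 (ii): at a GENUINE `p`-adic Frobenioid the entry-wise unit law «every
# self-equivalence over the identity of the base induces `u_{Ψ φ} = η^* u_φ`» is unsatisfiable
# (the unit twist by `w = −1 ∈ K^×`; OURS — a vacuity witness, not a construction of the paper)

Mochizuki, *The geometry of Frobenioids II: poly-Frobenioids*, Kyushu J. Math. **62** (2008) 401–460,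
§1 Example 1.1 (ii) p. 8: the `p`-adic Frobenioid is "the model Frobenioid associated to this data `Φ`,
`B → Φ^gp`" with `B := B₀|_D ×_{Φ₀^gp|_D} Φ^gp`, `B₀ = (Spec K ↦ K^×)` (Ex. 1.1 (i) p. 7: "the assignment
`Spec(K) ↦ K^×` determines a group-like monoid `B₀` on `D₀`") [cite: MochizukiFrdII2008, Ex 1.1 (ii) p.8];
the objects of the base lie over finite extensions `K` of `ℚ_p` (Ex. 1.1 (i) p. 7: "[i.e., `K` is a finite
extension of `ℚ_p`]"), typed as `PadicFrd.Datum.isPadicLocal` [cite: MochizukiFrdII2008, Ex 1.1 (i) p.7].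
Consumer locus: Mochizuki, *Inter-universal Teichmüller theory I*, proof of Cor. 5.3 (iv), kurims
manuscript (May 2020) p. 145 l. 3–4 "once one shows that `α` induces the identity on the rational function
and divisor monoids of `ℱ̲_v`" [cite: Mochizuki2012, Cor. 5.3(iv) p.145] (D-0012 claim key; nothing of that
series is asserted; no side taken on [IUTchIII] Cor. 3.12).

PROOF-ONLY instance (abc-iut cell, L5 row «HMON-LAW-VACUITY-WITNESS» = L5-R22, part 2) of abc-iut-L1-d3's
generic `ModelFrobenioid.not_forall_selfEquivalence_over_id_hdiv_hunit`
(`ModelFrobenioidUnitTwistVacuityWitness.lean`): for EVERY datum `d : PadicFrd.Datum D p` of a `p`-adic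
Frobenioid `𝒞 = ModelFrobenioid d.Φ d.B d.divB`, the family `w_A ∈ B(A)` lying over
`(−1, 0) ∈ K_A^× ×_{Φ₀^gp(A)} Φ^gp(A)` (abc-iut-L1-d10's `PadicFrd.Datum.exists_B_over_unit`, `isUnit_B`,
`B_ext`) is a divisor-free, base-compatible family of units with `w_A ≠ 1` (`−1 ≠ 1` in `K_A^×`,
`char K_A = 0` from `isPadicLocal`), so the displayed LAW `hmon` of
`Literature.IUT.HodgeTheaters.Cor53.descend_injective_model_of_monoidRigid` — copied verbatim at
`(Φ, B, Div_B) := (d.Φ, d.B, d.divB)` — is FALSE there: `PadicFrd.Datum.not_forall_selfEquivalence_over_id_hdiv_hunit`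
(and the three-clause / unit-only variants).  The knit's CONCLUSION (injectivity of `Aut(𝒞) → Aut(𝒟)`) is
not claimed false; what fails is OUR entry-wise typing of print's «identity on the rational function
monoid» (a statement about birational units, [FrdI] Thm. 5.2 (ii)).  Honest framing: nothing here asserts
abc proved or refuted; typed ≠ proved.
-/

namespace Literature.AlgebraicGeometry.Frobenioids

open CategoryTheory Opposite

universe v u

namespace PadicFrd.Datum

variable {D : Type u} [Category.{v} D] {p : ℕ} [Fact p.Prime] (d : Datum D p)

/-- `char K_A = 0`: "`K` is a finite extension of `ℚ_p`" (`isPadicLocal`). [cite: MochizukiFrdII2008, Ex 1.1 (i) p.7] -/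
theorem charZero_fld (A : D) : CharZero (d.fld A) := by
  obtain ⟨_, -⟩ := (d.isPadicLocal A).exists_finite
  exact charZero_of_injective_algebraMap (algebraMap ℚ_[p] (d.fld A)).injective

/-- The element of `B(A) = K_A^× ×_{Φ₀^gp(A)} Φ^gp(A)` over `(−1, 0)` exists (`−1 ∈ O_{K_A}^×`: its valuation
is `1` — cf. the universe-`0` form `Literature.IUT.HodgeTheaters.GoodLocalFrobenioid.neg_one_mem_unitSubgroup` /
`negOneB` of abc-iut-w4-d047, not importable here at `Category.{v} D`). [cite: MochizukiFrdII2008, Ex 1.1 (ii) p.8] -/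
theorem exists_B_over_neg_one (A : D) :
    ∃ u : d.B.obj (op A), (d.toB0.app (op A)).hom u = (-1 : (d.fld A)ˣ) ∧
      Frobenioids.divB d.Φ d.B d.divB (op A) u = 1 :=
  d.exists_B_over_unit (op A) (-1)
    (by rw [mem_unitSubgroup_iff, Units.val_neg, Units.val_one, Valuation.map_neg, map_one])

/-- **A divisor-free, base-compatible, non-trivial family of units of `B` at every `p`-adic Frobenioid**:
the elements `w_A ∈ B(A)` over `(−1, 0)` are units (`B(A)` is a group), have `Div_B(w_A) = 0`, satisfy
`B(f)(w_{A'}) = w_A` (both fibre-product components are natural and `σ(−1) = −1` for a ring homomorphism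
`σ`), and `w_A ≠ 1` for every (hence, `D` being connected, for some) `A`.  OURS; the input shape of
abc-iut-L1-d3's `ModelFrobenioid.exists_unitTwist_selfEquivalence`. [cite: MochizukiFrdII2008, Ex 1.1 (ii) p.8] -/
theorem exists_unitFamily_neg_one :
    ∃ w : ∀ A : D, d.B.obj (op A),
      (∀ A, IsUnit (w A)) ∧ (∀ A, Frobenioids.divB d.Φ d.B d.divB (op A) (w A) = 1) ∧
        (∀ ⦃A A' : D⦄ (f : A ⟶ A'), pull d.B f (w A') = w A) ∧ ∃ A, w A ≠ 1 := by
  choose w hw₁ hw₀ using fun A : D => d.exists_B_over_neg_one A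
  obtain ⟨A₀⟩ := d.isConnected_base.is_nonempty
  refine ⟨w, fun A => d.isUnit_B (op A) (w A), hw₀, fun A A' f => d.B_ext (op A) ?_ ?_, A₀, fun h => ?_⟩
  · -- the `K^×`-component: `B(f)` lies over `K_{A'}^× → K_A^×`, which maps `−1` to `−1`
    have n := congrArg (fun φ => φ.hom (w A')) (d.toB0.naturality f.op)
    simp only [CommMonCat.hom_comp, MonoidHom.comp_apply] at n
    change (d.toB0.app (op A)).hom ((d.B.map f.op).hom (w A')) = _
    rw [n, hw₁, hw₁]
    change Units.map ((d.base.map f).alg : d.fld A' →* d.fld A) (-1) = -1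
    refine Units.ext ?_
    simp only [Units.coe_map, MonoidHom.coe_coe, Units.val_neg, Units.val_one, map_neg, map_one]
  · -- the `Φ^gp`-component: `Div_B(B(f)(w_{A'})) = Φ(f)(Div_B(w_{A'})) = 0 = Div_B(w_A)`
    rw [hw₀]
    change Frobenioids.divB d.Φ d.B d.divB (op A) ((d.B.map f.op).hom (w A')) = 1
    rw [← pullGp_divB, hw₀, map_one]
  · -- `w_{A₀} = 1` would give `−1 = 1` in `K_{A₀}^×`, `char K_{A₀} = 0`
    haveI := d.charZero_fld A₀
    have h1 := hw₁ A₀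
    rw [h, map_one] at h1
    exact neg_units_ne_self (1 : (d.fld A₀)ˣ) h1.symm

/-- **¬ `hmon` at every genuine `p`-adic Frobenioid** — the displayed LAW of
`Literature.IUT.HodgeTheaters.Cor53.descend_injective_model_of_monoidRigid`, copied verbatim at the
`p`-adic Frobenioid `ModelFrobenioid d.Φ d.B d.divB` of a datum `d` ([FrdII] Ex. 1.1 (ii)), is FALSE:
the unit twist by the family over `−1 ∈ K^×` (`exists_unitFamily_neg_one`) is a self-equivalence lying
over the identity of `D` for which `u_{Ψ φ} = η^* u_φ` fails for every `η` (abc-iut-L1-d3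
`ModelFrobenioid.not_forall_selfEquivalence_over_id_hdiv_hunit`).  Hence that knit theorem is vacuous at
`p`-adic Frobenioids; its conclusion is not claimed false.  OURS, not a statement of either paper.
[cite: MochizukiFrdII2008, Ex 1.1 (ii) p.8] [cite: Mochizuki2012, Cor. 5.3(iv) p.145] -/
theorem not_forall_selfEquivalence_over_id_hdiv_hunit :
    ¬ (∀ Ψ : ModelFrobenioid d.Φ d.B d.divB ≌ ModelFrobenioid d.Φ d.B d.divB,
      Nonempty (Ψ.functor ⋙ ModelFrobenioid.baseFunctor d.Φ d.B d.divB ≅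
        ModelFrobenioid.baseFunctor d.Φ d.B d.divB) →
      ∃ η : Ψ.functor ⋙ ModelFrobenioid.baseFunctor d.Φ d.B d.divB ≅
          ModelFrobenioid.baseFunctor d.Φ d.B d.divB,
        (∀ ⦃X Y : ModelFrobenioid d.Φ d.B d.divB⦄ (φ : X ⟶ Y),
            ModelFrobenioid.div (Ψ.functor.map φ) =
              pull d.Φ (η.hom.app X : (Ψ.functor.obj X).base ⟶ X.base) (ModelFrobenioid.div φ)) ∧
        (∀ ⦃X Y : ModelFrobenioid d.Φ d.B d.divB⦄ (φ : X ⟶ Y),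
            ModelFrobenioid.unit (Ψ.functor.map φ) =
              pull d.B (η.hom.app X : (Ψ.functor.obj X).base ⟶ X.base) (ModelFrobenioid.unit φ))) := by
  obtain ⟨w, hwu, hw0, hwn, hw1⟩ := d.exists_unitFamily_neg_one
  exact ModelFrobenioid.not_forall_selfEquivalence_over_id_hdiv_hunit w hwu hw0 hwn hw1

/-- The three-clause form (the `hmon` of `Cor53.descend_injective_of_monoidRigid` /
`descendBijective_of_monoidRigid_of_lifts` / `mapIso_kindFunctor_bijective_of_monoidRigid_of_lifts`,
verbatim at `(d.Φ, d.B, d.divB)`) is FALSE at every `p`-adic Frobenioid as well.  OURS.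
[cite: MochizukiFrdII2008, Ex 1.1 (ii) p.8] [cite: Mochizuki2012, Cor. 5.3(iv) p.145] -/
theorem not_forall_selfEquivalence_over_id_hdeg_hdiv_hunit :
    ¬ (∀ Ψ : ModelFrobenioid d.Φ d.B d.divB ≌ ModelFrobenioid d.Φ d.B d.divB,
      Nonempty (Ψ.functor ⋙ ModelFrobenioid.baseFunctor d.Φ d.B d.divB ≅
        ModelFrobenioid.baseFunctor d.Φ d.B d.divB) →
      ∃ η : Ψ.functor ⋙ ModelFrobenioid.baseFunctor d.Φ d.B d.divB ≅
          ModelFrobenioid.baseFunctor d.Φ d.B d.divB,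
        (∀ ⦃X Y : ModelFrobenioid d.Φ d.B d.divB⦄ (φ : X ⟶ Y),
            ModelFrobenioid.degFr (Ψ.functor.map φ) = ModelFrobenioid.degFr φ) ∧
        (∀ ⦃X Y : ModelFrobenioid d.Φ d.B d.divB⦄ (φ : X ⟶ Y),
            ModelFrobenioid.div (Ψ.functor.map φ) =
              pull d.Φ (η.hom.app X : (Ψ.functor.obj X).base ⟶ X.base) (ModelFrobenioid.div φ)) ∧
        (∀ ⦃X Y : ModelFrobenioid d.Φ d.B d.divB⦄ (φ : X ⟶ Y),
            ModelFrobenioid.unit (Ψ.functor.map φ) =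
              pull d.B (η.hom.app X : (Ψ.functor.obj X).base ⟶ X.base) (ModelFrobenioid.unit φ))) := by
  obtain ⟨w, hwu, hw0, hwn, hw1⟩ := d.exists_unitFamily_neg_one
  exact ModelFrobenioid.not_forall_selfEquivalence_over_id_hdeg_hdiv_hunit w hwu hw0 hwn hw1

/-- The unit clause alone, as a law over all self-equivalences over the identity, is FALSE at every
`p`-adic Frobenioid.  OURS. [cite: MochizukiFrdII2008, Ex 1.1 (ii) p.8] -/
theorem not_forall_selfEquivalence_over_id_hunit :
    ¬ (∀ Ψ : ModelFrobenioid d.Φ d.B d.divB ≌ ModelFrobenioid d.Φ d.B d.divB,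
      Nonempty (Ψ.functor ⋙ ModelFrobenioid.baseFunctor d.Φ d.B d.divB ≅
        ModelFrobenioid.baseFunctor d.Φ d.B d.divB) →
      ∃ η : Ψ.functor ⋙ ModelFrobenioid.baseFunctor d.Φ d.B d.divB ≅
          ModelFrobenioid.baseFunctor d.Φ d.B d.divB,
        ∀ ⦃X Y : ModelFrobenioid d.Φ d.B d.divB⦄ (φ : X ⟶ Y),
            ModelFrobenioid.unit (Ψ.functor.map φ) =
              pull d.B (η.hom.app X : (Ψ.functor.obj X).base ⟶ X.base) (ModelFrobenioid.unit φ)) := by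
  obtain ⟨w, hwu, hw0, hwn, hw1⟩ := d.exists_unitFamily_neg_one
  exact ModelFrobenioid.not_forall_selfEquivalence_over_id_hunit w hwu hw0 hwn hw1

end PadicFrd.Datum

end Literature.AlgebraicGeometry.Frobenioids
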